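import Summits.Ventures.HodgeKum4.Invariants
import Literature.AlgebraicGeometry.HilbertScheme.LefschetzDualHilbertScheme
import Literature.AlgebraicGeometry.HilbertScheme.ChernCharacterWZeroModes
import Literature.AlgebraicGeometry.Hyperkaehler.GeneralizedKummerHilbertSchemePullback
import Literature.AlgebraicGeometry.Hyperkaehler.LLVStructureKummerType
import HarnessLib

/-!
# Lane (V) — definitions: `L1-Kum(n)`, `L1-Hilb(n)`, the transfer statement V0, the invariants bridge, and the
operator-calculus support statements (Lefschetz dual on `A^[n]` in Nakajima operators)

Cell `hodge-kum4` (ladder HodgeAV, rung H3), namespace `Summit.Ventures.HodgeKum4`; BRIEF-LANE-V.md v2 §4 F5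
(planner g15/g16), typed by the lane-V literature seat `hodge-lit-v0typer` for the planner to PLACE as
`Summits/Ventures/HodgeKum4/Theorems/LaneVDefs.lean` (a defs file like `KummerFixedLocusL1Defs.lean`).
HONEST FRAMING: every `def … : Prop` below is a STATEMENT OF OURS (an obligation: a support statement or the
`n`-indexed form of the cell's lemma L1) — not a Literature fact and not a theorem; the `theorem`s are kernel
glue (standard axioms, no `sorry`).  Nothing here asserts L1, L1-Hilb(n) (either form), K1_unif, V0, MODEL_X,
`HC_KumType n`, `HC_Kum4Type` or HC.

INDEX CONVENTION (the tree's, `Hyperkaehler.IsGeneralizedKummerVarietyOf n A K`: `K = Kⁿ(A) ⊂ A^[n+1]`,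
`dim K = 2n`): `LefschetzGenerationKum n` is about varieties of `Kumⁿ`-type (the cell's L1 is `n = 4`),
`LefschetzGenerationHilb n` is about the Hilbert scheme `A^[n]` of `n` points (the engine's index; the landed
`m = 5` certificate is `A^[5]`, `K⁴(A) ⊂ A^[5]`), and V0 links `A^[n+1]` with `Kⁿ(A)` (BRIEF §4 writes the
Hilbert index: its `3 ≤ n` is `2 ≤ n` below).

## Contents

* §1 `LefschetzGenerationKumAt X Λ`, **`LefschetzGenerationKum (n)`** — the text of
  `Invariants.LefschetzGenerationKum4` with `8 ↦ 2n`, `4 ↦ n`; `lefschetzGenerationKum_four : … 4 ↔ LefschetzGenerationKum4`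
  (`Iff.rfl`).
* §2 `LefschetzGenerationHilbAt Y Λ` (`⟨H⁰, H¹, H², H³⟩_{(Λ, ∪)} = H*(Y)`), **`LefschetzGenerationHilb (n)`** over the
  lane-V interface (`HilbertScheme.ChernCharacterOperators`, a Casimir element of the Poincaré pairing, `α ∈ H²(A)`
  with a dual Lefschetz operator `Λ_A` ON THE SURFACE — exists iff `(α, α) ≠ 0`): for every abelian surface and all
  such data, `H*(A^[n]) = ⟨H^{≤3}(A^[n])⟩_{(f_α, ∪)}` with `f_α = T(Λ_A)|_{A^[n]}` (BRIEF §2: the dual is the transfer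
  of the surface's dual Lefschetz operator, odd part included).
* §3 OPERATOR CALCULUS — no support statements are needed any more: the super-versions of Oberdieck's Lemma 3.4
  (`k = 1`) / Cor. 3.5 (BRIEF §4 F3 "`lieHom_odd`"), `T(h_S)|ₙ = h_{S^[n]}`, Lehn's `∪D_α = T(L_α)|ₙ` and D3
  ("`lefschetzDual_abelianSurface`": `(∪D_α, h_{S^[n]}, T(Λ_S)|ₙ)` is an `𝔰𝔩₂`-triple on `H*(S^[n])`) are Literature
  THEOREMS for every smooth projective surface, odd cohomology allowed, under the hypothesis that the Casimir tensor
  `C` is EVEN (`HilbertScheme.evenTensorSpan`; the Künneth class of the diagonal is):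
  `HilbertScheme.NakajimaOperators.transferOp_commute_super / transferOp_lie_super / transferOp_degreeOperator`,
  `HilbertScheme.ChernCharacterOperators.cupOperator_zero_eq_transferOp_super / totalLefschetz_divisorClass /
  isDualLefschetz_transferOp` (files `TransferOperatorSuperCommutators`, `LefschetzDualHilbertScheme`).
* §4 V0 = **`HilbertKummerTransfer`** (per matched pair of triples, "range form", no group `Γ` needed) and the bridge
  **`KummerRangeEqInvariants`** (`im θ* = H*(K)^{Γ(K)}`, `n ≥ 2`); §5 kernel glue
  `lefschetzGenerationKumAt_of_hilbAt` / `lefschetzGenerationKumAt_of_hilb`: V0 ∧ bridge ∧ L1-Hilb(n+1) ⟹ the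
  cell's L1 shape on `Kⁿ(A)` for the triples `(θ*D_α, h, Λ_K)` coming from surface classes `α` (D3 is now a
  theorem and is USED, not assumed); `lefschetzGenerationKumAt_of_one` (LieGen: one triple ⟹ every triple on `X`
  of `Kumⁿ`-type, via `LooijengaLuntsVerbitsky_llvStructure_kumType`, plan g16 (γ)) and the assembled
  `lefschetzGenerationKumAt_kummer_of_hilb` (= `LefschetzGenerationKum n` at `X = Kⁿ(A)` from the lane-V inputs).
* D3 SIGN (plan g16 06:36Z): pinned by the kernel — `NakajimaOperators.transferOp_commute_super` proves the letter
  rule `[T(φ), 𝔮_k(z)] = +kᵗ 𝔮_k(φz)` for the tree's conventions (`IsHeisenbergRepresentation.bracket`: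
  `[𝔮ₘ(a), 𝔮ₗ(b)} = m δ_{m+l,0}⟨a,b⟩`; `transferOp` with the leading `−` and the Casimir legs `𝔮ₙ(φεᵢ)𝔮₋ₙ(eᵢ)`,
  `Σᵢ⟨eᵢ,v⟩εᵢ = v`), so at `t = −1`, `n = 1`: `T(Λ)𝔮₁(z)|0⟩ = 𝔮₁(Λz)|0⟩` (= `+Λ` transported), and D3 is PROVED
  for all `n` with `h ≠ 0` (`ChernCharacterOperators.isDualLefschetz_transferOp`).

* §6 (APPEND, plan g17 ruling (ρ) 2026-08-27, `hodge-lit-lqw` design point) **`LefschetzGenerationHilbW (n)`** — the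
  `W`-FORM of L1-Hilb(n) (instance restricted by `HilbertScheme.ChernCharacterOperators.IsWZeroModes`; instances exist
  by `HilbertScheme.LiQinWang2002W_chernCharacter_zeroModes_abelianSurface`), `lefschetzGenerationHilbW_of_hilb` and the
  `W`-form glue `lefschetzGenerationKumAt_of_hilbW` / `lefschetzGenerationKumAt_kummer_of_hilbW`.
## SCOPE NOTE for the planner (what V0 does and does not transfer)

V0 matches ONE triple on `A^[n+1]` (class `ℓ`, in the application `ℓ = D_α`) with ONE triple on `K = Kⁿ(A)` (class
`θ*ℓ`); `LefschetzGenerationHilb (n+1)` therefore yields `LefschetzGenerationKumAt K Λ_K` for the duals `Λ_K` of the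
classes `θ*D_α ∈ H²(K)`, `α ∈ H²(A; ℂ)` with `(α, α) ≠ 0` — the hyperplane `δ^⊥ ⊂ H²(K)` of classes coming from the
surface — on the variety `Kⁿ(A)` ITSELF.  `LefschetzGenerationKum n` asks it for EVERY `ℓ ∈ H²(X)` with a dual and
every `X` of `Kumⁿ`-type: the passage to all `X` is the parallel-transport step of route №1 (not part of V0, BRIEF §4);
the passage from ONE (surface-class) triple to every `ℓ` on the same `X` IS supplied by the LLV structure theorem
(plan g16 ruling (γ); `lefschetzGenerationKumAt_of_one` below) — no cubic operators `e_δ, f_δ` are needed.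

## V0 — proof route (for the prover; all inputs refereed, OUTLOOK-n5 §11(5))

Beauville 1983 §7 / Kapfer–Menet Lemma 5.4: the `(n+1)⁴`-sheeted Galois cover `Θ : K × A → A^[n+1]`,
`Θ(ξ, a) = t_a(θ ξ)`, group `A[n+1]` acting diagonally (on `H*(A)` trivially); transfer:
`Θ* : H*(A^[n+1]) ≅ H*(K)^{A[n+1]} ⊗ H*(A)` as graded rings with `θ* = (id ⊗ ev₀) ∘ Θ*`, so `im θ* = H*(K)^{A[n+1]}`;
`Θ*ℓ = θ*ℓ ⊗ 1 + 1 ⊗ ℓ_A` (`H¹(K) = 0`); uniqueness of dual Lefschetz operators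
(`Hyperkaehler.IsDualLefschetz.eq_dual`) gives `Θ* Λ_H Θ*⁻¹ = Λ_K ⊗ 1 + 1 ⊗ Λ_A` (both `θ*ℓ` and `ℓ_A` are Lefschetz
when `ℓ` is); then `⟨H^{≤3}⟩_{(Λ,∪)} ⊆ S_K ⊗ H*(A)` (the right side contains the generators, is cup-closed and
`Λ`-stable) gives (⟹), and `{x | x ⊗ 1 ∈ S} ⊇ S_K` with `1 ⊗ H*(A) ⊆ S` (generated by `H¹(A)`) gives (⟸), where
`S_K = ⟨θ*H^{≤3}⟩_{(Λ_K,∪)}`.  MISSING INFRASTRUCTURE (flag): the translation action of `A` on `A^[n+1]`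
(`IsHilbertSchemeOfPoints.lift` of the translated universal family) and Beauville's equivariance
`Σ(t_a ξ) = Σ(ξ) + (n+1)a`; the points-free `IsGeneralizedKummerVarietyOf` does not expose `Θ`, and
`Hyperkaehler/GeneralizedKummerHilbertSchemePullback` records Kapfer–Menet Lemma 5.4 / Prop. 5.5 / 5.7 (`θ`, not `Θ`).
-/

noncomputable section

open CategoryTheory MonoidalCategory CartesianMonoidalCategory TensorProduct
open Literature.AlgebraicTopology.SingularHomology
open Literature.AlgebraicGeometry Literature.AlgebraicGeometry.Hyperkaehler Literature.AlgebraicGeometry.HilbertScheme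
open Literature.AlgebraicGeometry.HodgeTheory (complexBetti)

namespace Summit.Ventures.HodgeKum4

open scoped MonObj

/-! ### §1 L1 on the Kummer side, `n`-indexed -/

/-- **L1 at one triple on `X`**: the `Γ(X)`-invariant classes (`gammaInvariantClasses X`, `Γ(X) = autFixingH2H3 X`)
lie in the smallest subspace of `H*(X(ℂ); ℂ)` containing all classes of degrees `0, 2, 3`, closed under cup product
and stable under `Λ`. -/
def LefschetzGenerationKumAt (X : Motives.SchemeOver ℂ)
    (Λ : Module.End ℂ (totalCohomology ℂ (Motives.ComplexPoints X))) : Prop :=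
  gammaInvariantClasses X ≤
    opCupSpan ℂ (Motives.ComplexPoints X) Λ (degreeClasses ℂ (Motives.ComplexPoints X) {0, 2, 3})

/-- **L1-Kum(n)** — the text of `LefschetzGenerationKum4` with `8 ↦ 2n`, `4 ↦ n`: for every smooth projective `X` of
dimension `2n` of `Kumⁿ`-type and every `sl(2)`-triple `(L_ℓ, h, Λ)` on `H*(X(ℂ); ℂ)` with `ℓ ∈ H²`
(`IsDualLefschetz (2n) ℓ Λ`): `H*(X(ℂ); ℂ)^{Γ(X)} ⊆ ⟨H⁰, H², H³⟩_{(Λ, ∪)}`. -/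
def LefschetzGenerationKum (n : ℕ) : Prop :=
  ∀ ⦃X : Motives.SchemeOver ℂ⦄, Motives.IsSmoothProjective (2 * n) X → IsOfGeneralizedKummerType n X →
    ∀ (ℓ : complexBetti X 2) (Λ : Module.End ℂ (totalCohomology ℂ (Motives.ComplexPoints X))),
      IsDualLefschetz (2 * n) ℓ Λ →
        gammaInvariantClasses X ≤
          opCupSpan ℂ (Motives.ComplexPoints X) Λ (degreeClasses ℂ (Motives.ComplexPoints X) {0, 2, 3})

/-- `LefschetzGenerationKum 4` IS the cell's official L1 (`Invariants.LefschetzGenerationKum4`), by unfolding. -/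
theorem lefschetzGenerationKum_four : LefschetzGenerationKum 4 ↔ LefschetzGenerationKum4 :=
  Iff.rfl

/-- Unfolding: `LefschetzGenerationKum n` is `LefschetzGenerationKumAt` at every triple. -/
theorem lefschetzGenerationKum_iff (n : ℕ) :
    LefschetzGenerationKum n ↔
      ∀ ⦃X : Motives.SchemeOver ℂ⦄, Motives.IsSmoothProjective (2 * n) X → IsOfGeneralizedKummerType n X →
        ∀ (ℓ : complexBetti X 2) (Λ : Module.End ℂ (totalCohomology ℂ (Motives.ComplexPoints X))),
          IsDualLefschetz (2 * n) ℓ Λ → LefschetzGenerationKumAt X Λ :=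
  Iff.rfl

/-! ### §2 L1 on the Hilbert side -/

/-- **L1-Hilb at one operator on `Y`**: `H*(Y(ℂ); ℂ)` is the smallest subspace containing all classes of degrees
`0, 1, 2, 3`, closed under cup product and stable under `Λ` (the engine's verdict "EVERYTHING"). -/
def LefschetzGenerationHilbAt (Y : Motives.SchemeOver ℂ)
    (Λ : Module.End ℂ (totalCohomology ℂ (Motives.ComplexPoints Y))) : Prop :=
  opCupSpan ℂ (Motives.ComplexPoints Y) Λ (degreeClasses ℂ (Motives.ComplexPoints Y) {0, 1, 2, 3}) = ⊤

/-- **The operator `f_α|_{S^[n]} = T(Λ_S)|ₙ`** of the lane-V engine: the restriction to `H*(S^[n](ℂ); ℂ) = ℍₙ` of the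
transfer `T(Λ_S) = −Σ_{k≥1} k⁻² Σᵢ 𝔮_k(Λ_S εᵢ) 𝔮₋ₖ(eᵢ)` (`HeisenbergFockSpace.transferOp` with `t = −1`) of an
endomorphism `Λ_S` of `H*(S(ℂ); ℂ)` (the dual Lefschetz operator of `α` on the surface), for Nakajima operators `𝔮`
and a Casimir element `C = Σᵢ eᵢ ⊗ εᵢ` of the Poincaré pairing of `S`. -/
def transferDual {S : Motives.SchemeOver ℂ} {hS : Motives.IsSmoothProjective 2 S} {H : HilbertSchemesOfPoints S}
    (𝔑 : NakajimaOperators hS H)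
    (C : totalCohomology ℂ (Motives.ComplexPoints S) ⊗[ℂ] totalCohomology ℂ (Motives.ComplexPoints S))
    (Λ_S : Module.End ℂ (totalCohomology ℂ (Motives.ComplexPoints S))) (n : ℕ) :
    Module.End ℂ (totalCohomology ℂ (Motives.ComplexPoints (H.obj n))) :=
  restrictFock ℂ (fockFamily H) (transferOp ℂ 𝔑.q C (-1) Λ_S) n

/-- Unfolding of `transferDual`. -/
theorem transferDual_def {S : Motives.SchemeOver ℂ} {hS : Motives.IsSmoothProjective 2 S} {H : HilbertSchemesOfPoints S}
    (𝔑 : NakajimaOperators hS H)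
    (C : totalCohomology ℂ (Motives.ComplexPoints S) ⊗[ℂ] totalCohomology ℂ (Motives.ComplexPoints S))
    (Λ_S : Module.End ℂ (totalCohomology ℂ (Motives.ComplexPoints S))) (n : ℕ) :
    transferDual 𝔑 C Λ_S n = restrictFock ℂ (fockFamily H) (transferOp ℂ 𝔑.q C (-1) Λ_S) n :=
  rfl

/-- **L1-Hilb(n)** (BRIEF-LANE-V §4 F5; OUTLOOK-n5 §11(6)): for every abelian surface `A`, every choice `H` of its
Hilbert schemes of points with Chern character operators `𝔊` (the lane-V interface; instances exist by the
Literature facts `LiQinWang2002_chernCharacterOperators` / `LiQinWang2002W_chernCharacter_abelianSurface`), every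
EVEN Casimir tensor `C` of the Poincaré pairing of `A` (the Künneth class of the diagonal; `HilbertScheme.evenTensorSpan`),
and every `α ∈ H²(A(ℂ); ℂ)` with a dual Lefschetz
operator `Λ_A` on `H*(A(ℂ); ℂ)` (exists iff `(α, α) ≠ 0`):
`H*(A^[n](ℂ); ℂ) = ⟨H⁰, H¹, H², H³⟩_{(f_α, ∪)}` with `f_α = T(Λ_A)|_{A^[n]}` (`transferDual`). -/
def LefschetzGenerationHilb (n : ℕ) : Prop :=
  ∀ ⦃A : Motives.AbelianVariety ℂ⦄, A.dim = 2 → ∀ (hS : Motives.IsSmoothProjective 2 A.X)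
    (H : HilbertSchemesOfPoints A.X) (𝔊 : ChernCharacterOperators hS H)
    (C : totalCohomology ℂ (Motives.ComplexPoints A.X) ⊗[ℂ] totalCohomology ℂ (Motives.ComplexPoints A.X)),
    C ∈ evenTensorSpan ℂ (coeffFamily A.X) → IsCasimir ℂ (poincarePairing hS) C →
    ∀ (α : complexBetti A.X 2) (Λ_A : Module.End ℂ (totalCohomology ℂ (Motives.ComplexPoints A.X))),
      IsDualLefschetz 2 α Λ_A → LefschetzGenerationHilbAt (H.obj n) (transferDual 𝔊.toNakajimaOperators C Λ_A n)

/-! ### §3 Operator calculus: see the module docstring — `HilbertScheme.ChernCharacterOperators.isDualLefschetz_transferOp`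
(D3), `NakajimaOperators.transferOp_commute_super` / `transferOp_lie_super` / `transferOp_degreeOperator` are
Literature theorems (even Casimir tensor). -/

/-! ### §4 V0 — the Hilbert ⟷ Kummer transfer, and the invariants bridge -/

/-- **L1 in range form at one triple on a Kummer fibre `j : K ⟶ H`**: the image of
`θ* = j(ℂ)* : H*(H(ℂ); ℂ) → H*(K(ℂ); ℂ)` lies in the smallest subspace containing `θ*` of the classes of degrees
`≤ 3`, closed under cup product and stable under `Λ_K`. -/
def KummerRangeGeneration {K H : Motives.SchemeOver ℂ} (j : K ⟶ H)
    (Λ_K : Module.End ℂ (totalCohomology ℂ (Motives.ComplexPoints K))) : Prop :=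
  LinearMap.range (totalPullback ℂ (Motives.AlgPoints.mapContinuous (L := ℂ) j)) ≤
    opCupSpan ℂ (Motives.ComplexPoints K) Λ_K
      (totalPullback ℂ (Motives.AlgPoints.mapContinuous (L := ℂ) j) ''
        degreeClasses ℂ (Motives.ComplexPoints H) {0, 1, 2, 3})

/-- **V0 — HILBERT ⟷ KUMMER TRANSFER (support statement, ours; BRIEF-LANE-V §4, OUTLOOK-n5 §11(5)).**  For every
abelian surface `A`, every `n`, every Hilbert scheme `(H, Ξ)` of `n + 1` points of `A`, smooth projective of
dimension `2(n+1)`, every generalized Kummer fibre `j : K ⟶ H` (the fibre of `alb − alb(x₀)` over the unit — the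
clauses of `Hyperkaehler.IsGeneralizedKummerVarietyOf n A K` — with `K` smooth projective of dimension `2n`), every
`ℓ ∈ H²(H(ℂ); ℂ)` with a dual Lefschetz operator `Λ_H` on `H` and a dual Lefschetz operator `Λ_K` of `θ*ℓ` on `K`:
L1-Hilb at `(H, Λ_H)` holds iff L1 in range form holds at `(j, Λ_K)`.  (No lower bound on `n` is needed for the
equivalence; the bridge to `Γ(K)`-invariants needs `n ≥ 2`.) -/
def HilbertKummerTransfer : Prop :=
  ∀ ⦃n : ℕ⦄ ⦃A : Motives.AbelianVariety ℂ⦄ ⦃K H : Motives.SchemeOver ℂ⦄, A.dim = 2 →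
    ∀ (Ξ : (A.X ⊗ H).left.IdealSheafData) (𝒜 : Motives.Jacobian H) (x₀ : 𝟙_ (Motives.SchemeOver ℂ) ⟶ H)
      (j : K ⟶ H), HilbertScheme.IsHilbertSchemeOfPoints (n + 1) A.X H Ξ →
      Motives.IsSmoothProjective (2 * (n + 1)) H →
      IsPullback j (toUnit K) (lift (𝟙 H) (toUnit H ≫ x₀) ≫ 𝒜.diff) (1 : 𝟙_ (Motives.SchemeOver ℂ) ⟶ 𝒜.J.X) →
      Motives.IsSmoothProjective (2 * n) K →
      ∀ (ℓ : complexBetti H 2) (Λ_H : Module.End ℂ (totalCohomology ℂ (Motives.ComplexPoints H)))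
        (Λ_K : Module.End ℂ (totalCohomology ℂ (Motives.ComplexPoints K))),
        IsDualLefschetz (2 * (n + 1)) ℓ Λ_H → IsDualLefschetz (2 * n) (complexBetti.map j 2 ℓ) Λ_K →
        (LefschetzGenerationHilbAt H Λ_H ↔ KummerRangeGeneration j Λ_K)

/-- **Bridge (support statement, ours): `im θ* = H*(K)^{Γ(K)}` for `n ≥ 2`** — for a Kummer fibre `j : K ⟶ H` as in
V0 with `n ≥ 2`, the image of `θ*` is the subspace `gammaInvariantClasses K` of classes invariant under
`Γ(K) = autFixingH2H3 K`.  Inputs for the proof: the Galois cover `Θ` (Beauville §7, Kapfer–Menet Lemma 5.4: transfer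
for the finite quotient gives `im θ* = H*(K)^{A[n+1]}`) and `Γ(Kⁿ(A)) = A[n+1]` for `n ≥ 2` (Boissière–Nieper-Wißkirchen–
Sarti 2011; Oguiso 2020 for `H³`; false at `n = 1`, where `A[2]` moves `H²` of the Kummer surface). -/
def KummerRangeEqInvariants : Prop :=
  ∀ ⦃n : ℕ⦄ ⦃A : Motives.AbelianVariety ℂ⦄ ⦃K H : Motives.SchemeOver ℂ⦄, A.dim = 2 → 2 ≤ n →
    ∀ (Ξ : (A.X ⊗ H).left.IdealSheafData) (𝒜 : Motives.Jacobian H) (x₀ : 𝟙_ (Motives.SchemeOver ℂ) ⟶ H)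
      (j : K ⟶ H), HilbertScheme.IsHilbertSchemeOfPoints (n + 1) A.X H Ξ →
      Motives.IsSmoothProjective (2 * (n + 1)) H →
      IsPullback j (toUnit K) (lift (𝟙 H) (toUnit H ≫ x₀) ≫ 𝒜.diff) (1 : 𝟙_ (Motives.SchemeOver ℂ) ⟶ 𝒜.J.X) →
      Motives.IsSmoothProjective (2 * n) K →
      LinearMap.range (totalPullback ℂ (Motives.AlgPoints.mapContinuous (L := ℂ) j)) = gammaInvariantClasses K

/-! ### §5 Kernel glue -/

/-- `θ*` maps the homogeneous classes of degrees in `D` of `H` to homogeneous classes of degrees in `D` of `K`. -/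
theorem image_degreeClasses_subset {K H : Motives.SchemeOver ℂ} (j : K ⟶ H) (D : Set ℕ) :
    totalPullback ℂ (Motives.AlgPoints.mapContinuous (L := ℂ) j) '' degreeClasses ℂ (Motives.ComplexPoints H) D ⊆
      degreeClasses ℂ (Motives.ComplexPoints K) D := by
  rintro _ ⟨v, hv, rfl⟩
  simp only [degreeClasses, Set.mem_iUnion, Set.mem_range] at hv ⊢
  obtain ⟨k, hk, x, rfl⟩ := hv
  exact ⟨k, hk, _, (totalPullback_lof _ k x).symm⟩

/-- A larger generating set gives a larger `(Λ, ∪)`-span. -/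
theorem opCupSpan_mono {Y : Type} [TopologicalSpace Y] (Λ : Module.End ℂ (totalCohomology ℂ Y))
    {G G' : Set (totalCohomology ℂ Y)} (h : G ⊆ G') : opCupSpan ℂ Y Λ G ≤ opCupSpan ℂ Y Λ G' :=
  opCupSpan_le (h.trans subset_opCupSpan) isCupClosed_opCupSpan mem_stabilizerLie_opCupSpan

/-- With `H¹(K(ℂ); ℂ) = 0` the classes of degrees `0, 1, 2, 3` of `K` generate the same `(Λ, ∪)`-span as those of
degrees `0, 2, 3`. -/
theorem opCupSpan_degreeClasses_le_of_h1 {K : Motives.SchemeOver ℂ} (h1 : ∀ x : complexBetti K 1, x = 0)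
    (Λ : Module.End ℂ (totalCohomology ℂ (Motives.ComplexPoints K))) :
    opCupSpan ℂ (Motives.ComplexPoints K) Λ (degreeClasses ℂ (Motives.ComplexPoints K) {0, 1, 2, 3}) ≤
      opCupSpan ℂ (Motives.ComplexPoints K) Λ (degreeClasses ℂ (Motives.ComplexPoints K) {0, 2, 3}) := by
  refine opCupSpan_le ?_ isCupClosed_opCupSpan mem_stabilizerLie_opCupSpan
  intro v hv
  simp only [degreeClasses, Set.mem_iUnion, Set.mem_range] at hv
  obtain ⟨k, hk, x, rfl⟩ := hv
  rcases hk with rfl | rfl | rfl | rfl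
  · exact subset_opCupSpan (by simp [degreeClasses])
  · rw [h1 x, map_zero]; exact Submodule.zero_mem _
  · exact subset_opCupSpan (by simp [degreeClasses])
  · exact subset_opCupSpan (by simp [degreeClasses])

/-- **GLUE (one triple).**  V0 ∧ bridge ∧ (L1-Hilb at `(H, Λ_H)`) ⟹ L1 at `(K, Λ_K)` (`LefschetzGenerationKumAt`) for
a Kummer fibre `j : K ⟶ H` of index `n ≥ 2` with `H¹(K(ℂ); ℂ) = 0`, `ℓ ∈ H²(H)` with dual `Λ_H`, and `Λ_K` a dual
of `θ*ℓ` on `K`. -/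
theorem lefschetzGenerationKumAt_of_hilbAt (hV0 : HilbertKummerTransfer) (hB : KummerRangeEqInvariants) ⦃n : ℕ⦄
    ⦃A : Motives.AbelianVariety ℂ⦄ ⦃K H : Motives.SchemeOver ℂ⦄ (hA : A.dim = 2) (hn : 2 ≤ n)
    (Ξ : (A.X ⊗ H).left.IdealSheafData) (𝒜 : Motives.Jacobian H) (x₀ : 𝟙_ (Motives.SchemeOver ℂ) ⟶ H) (j : K ⟶ H)
    (hHilb : HilbertScheme.IsHilbertSchemeOfPoints (n + 1) A.X H Ξ) (hH : Motives.IsSmoothProjective (2 * (n + 1)) H)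
    (hsq : IsPullback j (toUnit K) (lift (𝟙 H) (toUnit H ≫ x₀) ≫ 𝒜.diff) (1 : 𝟙_ (Motives.SchemeOver ℂ) ⟶ 𝒜.J.X))
    (hKs : Motives.IsSmoothProjective (2 * n) K) (h1 : ∀ x : complexBetti K 1, x = 0) (ℓ : complexBetti H 2)
    (Λ_H : Module.End ℂ (totalCohomology ℂ (Motives.ComplexPoints H)))
    (Λ_K : Module.End ℂ (totalCohomology ℂ (Motives.ComplexPoints K))) (hΛH : IsDualLefschetz (2 * (n + 1)) ℓ Λ_H)
    (hΛK : IsDualLefschetz (2 * n) (complexBetti.map j 2 ℓ) Λ_K) (hgen : LefschetzGenerationHilbAt H Λ_H) :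
    LefschetzGenerationKumAt K Λ_K := by
  rw [LefschetzGenerationKumAt, ← hB hA hn Ξ 𝒜 x₀ j hHilb hH hsq hKs]
  exact ((hV0 hA Ξ 𝒜 x₀ j hHilb hH hsq hKs ℓ Λ_H Λ_K hΛH hΛK).1 hgen).trans
    ((opCupSpan_mono Λ_K (image_degreeClasses_subset j _)).trans (opCupSpan_degreeClasses_le_of_h1 h1 Λ_K))

/-- **GLUE (the lane-V chain at Hilbert index `n + 1`).**  V0 ∧ bridge ∧ L1-Hilb(n+1) ⟹ for every abelian surface
`A`, every choice `H` of its Hilbert schemes with Chern character operators `𝔊` and even Casimir tensor `C`, every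
Kummer fibre `j : K ⟶ A^[n+1]` (`n ≥ 2`, `H¹(K) = 0`), every `α ∈ H²(A)` with a dual `Λ_A` on the surface and every
dual `Λ_K` of `θ*D_α` on `K`: L1 holds at `(K, Λ_K)`.  D3 (`HilbertScheme.ChernCharacterOperators.
isDualLefschetz_transferOp`) supplies the `𝔰𝔩₂`-triple `(∪D_α, h, T(Λ_A)|_{n+1})` on `H*(A^[n+1])`; its side
condition `h_{A^[n+1]} ≠ 0` (`= 1_{A^[n+1]} ≠ 0`, `Hyperkaehler.degreeOperator_ne_zero_of_ne_zero`) is kept as the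
hypothesis `hh`. -/
theorem lefschetzGenerationKumAt_of_hilb (hV0 : HilbertKummerTransfer) (hB : KummerRangeEqInvariants) {n : ℕ}
    (hL : LefschetzGenerationHilb (n + 1)) ⦃A : Motives.AbelianVariety ℂ⦄ ⦃K : Motives.SchemeOver ℂ⦄ (hA : A.dim = 2)
    (hn : 2 ≤ n) (hS : Motives.IsSmoothProjective 2 A.X) (H : HilbertSchemesOfPoints A.X)
    (𝔊 : ChernCharacterOperators hS H)
    {C : totalCohomology ℂ (Motives.ComplexPoints A.X) ⊗[ℂ] totalCohomology ℂ (Motives.ComplexPoints A.X)}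
    (hCg : C ∈ evenTensorSpan ℂ (coeffFamily A.X)) (hC : IsCasimir ℂ (poincarePairing hS) C)
    (hh : degreeOperator ℂ (Motives.ComplexPoints (H.obj (n + 1))) (2 * (n + 1)) ≠ 0)
    (𝒜 : Motives.Jacobian (H.obj (n + 1))) (x₀ : 𝟙_ (Motives.SchemeOver ℂ) ⟶ H.obj (n + 1)) (j : K ⟶ H.obj (n + 1))
    (hsq : IsPullback j (toUnit K) (lift (𝟙 (H.obj (n + 1))) (toUnit (H.obj (n + 1)) ≫ x₀) ≫ 𝒜.diff)
      (1 : 𝟙_ (Motives.SchemeOver ℂ) ⟶ 𝒜.J.X))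
    (hKs : Motives.IsSmoothProjective (2 * n) K) (h1 : ∀ x : complexBetti K 1, x = 0) (α : complexBetti A.X 2)
    (Λ_A : Module.End ℂ (totalCohomology ℂ (Motives.ComplexPoints A.X))) (hΛA : IsDualLefschetz 2 α Λ_A)
    (Λ_K : Module.End ℂ (totalCohomology ℂ (Motives.ComplexPoints K)))
    (hΛK : IsDualLefschetz (2 * n) (complexBetti.map j 2 (𝔊.divisorClass (n + 1) α)) Λ_K) :
    LefschetzGenerationKumAt K Λ_K :=
  lefschetzGenerationKumAt_of_hilbAt hV0 hB hA hn (H.fam (n + 1)) 𝒜 x₀ j (H.isHilbertScheme (n + 1))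
    (H.smooth (n + 1)) hsq hKs h1 (𝔊.divisorClass (n + 1) α) (transferDual 𝔊.toNakajimaOperators C Λ_A (n + 1)) Λ_K
    (𝔊.isDualLefschetz_transferOp hCg hC hΛA hh) hΛK (hL hA hS H 𝔊 C hCg hC α Λ_A hΛA)

/-- **LieGen glue (plan g16 (γ)): one dual Lefschetz operator suffices.**  On `X` of `Kumⁿ`-type (`n ≥ 1`), if L1
holds at ONE `𝔰𝔩₂`-triple `(L_{ℓ₀}, h, Λ₀)` — e.g. `Λ₀ = T(Λ_A)|ₙ₊₁`-transported, a surface-class triple — then it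
holds at EVERY triple `(L_ℓ, h, Λ)`: `H*(X)^{Γ} ⊆ ⟨H^{0,2,3}⟩_{(Λ₀,∪)} ⊆ ⟨H^{0,2,3}⟩_{(𝔤_tot,∪)} ⊆ ⟨H^{0,2,3}⟩_{(Λ,∪)}`,
the last step by the REFEREED LLV structure theorem for `Kumⁿ`-type (`𝔤_tot ⊆ Lie⟨L_{H²}, Λ⟩`,
`Hyperkaehler.LooijengaLuntsVerbitsky_llvStructure_kumType`, hypothesis `hF`) exactly as in the `n = 4` closer
`lefschetzGenerationKum4Frame_of_model`. -/
theorem lefschetzGenerationKumAt_of_one (hF : LooijengaLuntsVerbitsky_llvStructure_kumType) {n : ℕ} (hn : 1 ≤ n)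
    {X : Motives.SchemeOver ℂ} (hX : Motives.IsSmoothProjective (2 * n) X) (hK : IsOfGeneralizedKummerType n X)
    {ℓ₀ : complexBetti X 2} {Λ₀ : Module.End ℂ (totalCohomology ℂ (Motives.ComplexPoints X))}
    (hΛ₀ : IsDualLefschetz (2 * n) ℓ₀ Λ₀) (h₀ : LefschetzGenerationKumAt X Λ₀) (ℓ : complexBetti X 2)
    (Λ : Module.End ℂ (totalCohomology ℂ (Motives.ComplexPoints X))) (hΛ : IsDualLefschetz (2 * n) ℓ Λ) :
    LefschetzGenerationKumAt X Λ :=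
  h₀.trans ((opCupSpan_le_llvCupSpan (dual_mem hΛ₀)).trans
    (llvCupSpan_le_opCupSpan
      (LooijengaLuntsVerbitsky_llvStructure_kumType.llvAlgebra_le_lieSpan hF hn hX hK ℓ Λ hΛ)
      fun a ↦ ofDegree_mem_degreeClasses (by simp) a))

/-- **The lane-V chain on a generalized Kummer variety, every triple.**  V0 ∧ bridge ∧ L1-Hilb(n+1) ∧ LLV structure ⟹
for `K = Kⁿ(A) ⊂ A^[n+1]` (as a Kummer fibre of the chosen Hilbert scheme, `n ≥ 2`, `H¹(K) = 0`, `K` of `Kumⁿ`-type),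
ONE surface class `α` with a dual `Λ_A` on `A` and a dual `Λ₀` of `θ*D_α` on `K`: L1 holds at EVERY `𝔰𝔩₂`-triple of
`K` — `LefschetzGenerationKum n` restricted to `X = K`.  («all `A` ⇒ all `X` of `Kumⁿ`-type» is the parallel-transport
step of route №1, not lane V.) -/
theorem lefschetzGenerationKumAt_kummer_of_hilb (hV0 : HilbertKummerTransfer) (hB : KummerRangeEqInvariants)
    (hF : LooijengaLuntsVerbitsky_llvStructure_kumType) {n : ℕ} (hL : LefschetzGenerationHilb (n + 1))
    ⦃A : Motives.AbelianVariety ℂ⦄ ⦃K : Motives.SchemeOver ℂ⦄ (hA : A.dim = 2) (hn : 2 ≤ n)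
    (hS : Motives.IsSmoothProjective 2 A.X) (H : HilbertSchemesOfPoints A.X) (𝔊 : ChernCharacterOperators hS H)
    {C : totalCohomology ℂ (Motives.ComplexPoints A.X) ⊗[ℂ] totalCohomology ℂ (Motives.ComplexPoints A.X)}
    (hCg : C ∈ evenTensorSpan ℂ (coeffFamily A.X)) (hC : IsCasimir ℂ (poincarePairing hS) C)
    (hh : degreeOperator ℂ (Motives.ComplexPoints (H.obj (n + 1))) (2 * (n + 1)) ≠ 0)
    (𝒜 : Motives.Jacobian (H.obj (n + 1))) (x₀ : 𝟙_ (Motives.SchemeOver ℂ) ⟶ H.obj (n + 1)) (j : K ⟶ H.obj (n + 1))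
    (hsq : IsPullback j (toUnit K) (lift (𝟙 (H.obj (n + 1))) (toUnit (H.obj (n + 1)) ≫ x₀) ≫ 𝒜.diff)
      (1 : 𝟙_ (Motives.SchemeOver ℂ) ⟶ 𝒜.J.X))
    (hKs : Motives.IsSmoothProjective (2 * n) K) (hKt : IsOfGeneralizedKummerType n K)
    (h1 : ∀ x : complexBetti K 1, x = 0) {α : complexBetti A.X 2}
    {Λ_A : Module.End ℂ (totalCohomology ℂ (Motives.ComplexPoints A.X))} (hΛA : IsDualLefschetz 2 α Λ_A)
    {Λ₀ : Module.End ℂ (totalCohomology ℂ (Motives.ComplexPoints K))}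
    (hΛ₀ : IsDualLefschetz (2 * n) (complexBetti.map j 2 (𝔊.divisorClass (n + 1) α)) Λ₀) (ℓ : complexBetti K 2)
    (Λ : Module.End ℂ (totalCohomology ℂ (Motives.ComplexPoints K))) (hΛ : IsDualLefschetz (2 * n) ℓ Λ) :
    LefschetzGenerationKumAt K Λ :=
  lefschetzGenerationKumAt_of_one hF (by omega) hKs hKt hΛ₀
    (lefschetzGenerationKumAt_of_hilb hV0 hB hL hA hn hS H 𝔊 hCg hC hh 𝒜 x₀ j hsq hKs h1 α Λ_A hΛA Λ₀ hΛ₀) ℓ Λ hΛ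

/-! ### §6 The `W`-form of L1-Hilb(n) (APPEND — plan g17 ruling (ρ), 2026-08-27; `hodge-lit-lqw` design point) -/

/-- **L1-Hilb(n), `W`-form** — the text of `LefschetzGenerationHilb n` with the instance `𝔊` restricted to those whose
Chern character operators ARE the `W`-algebra zero-modes (`HilbertScheme.ChernCharacterOperators.IsWZeroModes 𝔊`: Lehn's
derivative formula, Li–Qin–Wang's bracket formula, IMRN 2002 Thm. 4.6; instances exist for every abelian surface and every `H`
by the REFEREED fact `HilbertScheme.LiQinWang2002W_chernCharacter_zeroModes_abelianSurface`).  The WEAKEST form the lane-(V)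
feeder consumes (L1 needs L1-Hilb at ONE instance) and the one a certificate discharges by unfolding; the `∀`-instance form
`LefschetzGenerationHilb n` is STRONGER (the interface does not pin `𝔊ₖ`, `k ≥ 1`: the `ξ`-shift `G₁(γ, n) ↦ G₁(γ, n) + G₀(ξγ, n)`
is again an instance) and implies it (`lefschetzGenerationHilbW_of_hilb`).  A STATEMENT OF OURS; nothing asserted. -/
def LefschetzGenerationHilbW (n : ℕ) : Prop :=
  ∀ ⦃A : Motives.AbelianVariety ℂ⦄, A.dim = 2 → ∀ (hS : Motives.IsSmoothProjective 2 A.X) (H : HilbertSchemesOfPoints A.X)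
    (𝔊 : ChernCharacterOperators hS H), 𝔊.IsWZeroModes →
    ∀ (C : totalCohomology ℂ (Motives.ComplexPoints A.X) ⊗[ℂ] totalCohomology ℂ (Motives.ComplexPoints A.X)),
    C ∈ evenTensorSpan ℂ (coeffFamily A.X) → IsCasimir ℂ (poincarePairing hS) C → ∀ (α : complexBetti A.X 2)
      (Λ_A : Module.End ℂ (totalCohomology ℂ (Motives.ComplexPoints A.X))),
      IsDualLefschetz 2 α Λ_A → LefschetzGenerationHilbAt (H.obj n) (transferDual 𝔊.toNakajimaOperators C Λ_A n)

/-- **The `∀`-instance form implies the `W`-form** (forget the zero-mode hypothesis); keeps every line proving the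
`∀`-form (e.g. the V2 skeleton's `lefschetzGenerationHilb_allN_of`) one application away from the `W`-form item. -/
theorem lefschetzGenerationHilbW_of_hilb {n : ℕ} (h : LefschetzGenerationHilb n) : LefschetzGenerationHilbW n :=
  fun _A hA hS H 𝔊 _ C hCg hC α Λ_A hΛA ↦ h hA hS H 𝔊 C hCg hC α Λ_A hΛA

/-- **GLUE, `W`-form (the lane-V chain at Hilbert index `n + 1`, one zero-mode instance).**  V0 ∧ bridge ∧
L1-HilbW(n+1) ⟹ L1 at `(K, Λ_K)` — `lefschetzGenerationKumAt_of_hilb` verbatim with `h𝔊 : 𝔊.IsWZeroModes` passed to `hL`. -/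
theorem lefschetzGenerationKumAt_of_hilbW (hV0 : HilbertKummerTransfer) (hB : KummerRangeEqInvariants) {n : ℕ}
    (hL : LefschetzGenerationHilbW (n + 1)) ⦃A : Motives.AbelianVariety ℂ⦄ ⦃K : Motives.SchemeOver ℂ⦄ (hA : A.dim = 2)
    (hn : 2 ≤ n) (hS : Motives.IsSmoothProjective 2 A.X) (H : HilbertSchemesOfPoints A.X) (𝔊 : ChernCharacterOperators hS H)
    (h𝔊 : 𝔊.IsWZeroModes) {C : totalCohomology ℂ (Motives.ComplexPoints A.X) ⊗[ℂ] totalCohomology ℂ (Motives.ComplexPoints A.X)}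
    (hCg : C ∈ evenTensorSpan ℂ (coeffFamily A.X)) (hC : IsCasimir ℂ (poincarePairing hS) C)
    (hh : degreeOperator ℂ (Motives.ComplexPoints (H.obj (n + 1))) (2 * (n + 1)) ≠ 0)
    (𝒜 : Motives.Jacobian (H.obj (n + 1))) (x₀ : 𝟙_ (Motives.SchemeOver ℂ) ⟶ H.obj (n + 1)) (j : K ⟶ H.obj (n + 1))
    (hsq : IsPullback j (toUnit K) (lift (𝟙 (H.obj (n + 1))) (toUnit (H.obj (n + 1)) ≫ x₀) ≫ 𝒜.diff)
      (1 : 𝟙_ (Motives.SchemeOver ℂ) ⟶ 𝒜.J.X)) (hKs : Motives.IsSmoothProjective (2 * n) K) (h1 : ∀ x : complexBetti K 1, x = 0)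
    (α : complexBetti A.X 2) (Λ_A : Module.End ℂ (totalCohomology ℂ (Motives.ComplexPoints A.X))) (hΛA : IsDualLefschetz 2 α Λ_A)
    (Λ_K : Module.End ℂ (totalCohomology ℂ (Motives.ComplexPoints K)))
    (hΛK : IsDualLefschetz (2 * n) (complexBetti.map j 2 (𝔊.divisorClass (n + 1) α)) Λ_K) : LefschetzGenerationKumAt K Λ_K :=
  lefschetzGenerationKumAt_of_hilbAt hV0 hB hA hn (H.fam (n + 1)) 𝒜 x₀ j (H.isHilbertScheme (n + 1))
    (H.smooth (n + 1)) hsq hKs h1 (𝔊.divisorClass (n + 1) α) (transferDual 𝔊.toNakajimaOperators C Λ_A (n + 1)) Λ_K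
    (𝔊.isDualLefschetz_transferOp hCg hC hΛA hh) hΛK (hL hA hS H 𝔊 h𝔊 C hCg hC α Λ_A hΛA)

/-- **The lane-V chain on a generalized Kummer variety, every triple — `W`-form**: V0 ∧ bridge ∧ L1-HilbW(n+1) ∧ LLV
structure ⟹ L1 at EVERY `𝔰𝔩₂`-triple of `K = Kⁿ(A) ⊂ A^[n+1]` (`n ≥ 2`, `H¹(K) = 0`, `K` of `Kumⁿ`-type), given ONE zero-mode
instance `𝔊`, ONE surface class `α` with duals `Λ_A` and `Λ₀`; `lefschetzGenerationKumAt_kummer_of_hilb` with `h𝔊` threaded. -/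
theorem lefschetzGenerationKumAt_kummer_of_hilbW (hV0 : HilbertKummerTransfer) (hB : KummerRangeEqInvariants)
    (hF : LooijengaLuntsVerbitsky_llvStructure_kumType) {n : ℕ} (hL : LefschetzGenerationHilbW (n + 1))
    ⦃A : Motives.AbelianVariety ℂ⦄ ⦃K : Motives.SchemeOver ℂ⦄ (hA : A.dim = 2) (hn : 2 ≤ n) (hS : Motives.IsSmoothProjective 2 A.X)
    (H : HilbertSchemesOfPoints A.X) (𝔊 : ChernCharacterOperators hS H) (h𝔊 : 𝔊.IsWZeroModes)
    {C : totalCohomology ℂ (Motives.ComplexPoints A.X) ⊗[ℂ] totalCohomology ℂ (Motives.ComplexPoints A.X)}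
    (hCg : C ∈ evenTensorSpan ℂ (coeffFamily A.X)) (hC : IsCasimir ℂ (poincarePairing hS) C)
    (hh : degreeOperator ℂ (Motives.ComplexPoints (H.obj (n + 1))) (2 * (n + 1)) ≠ 0)
    (𝒜 : Motives.Jacobian (H.obj (n + 1))) (x₀ : 𝟙_ (Motives.SchemeOver ℂ) ⟶ H.obj (n + 1)) (j : K ⟶ H.obj (n + 1))
    (hsq : IsPullback j (toUnit K) (lift (𝟙 (H.obj (n + 1))) (toUnit (H.obj (n + 1)) ≫ x₀) ≫ 𝒜.diff)
      (1 : 𝟙_ (Motives.SchemeOver ℂ) ⟶ 𝒜.J.X)) (hKs : Motives.IsSmoothProjective (2 * n) K) (hKt : IsOfGeneralizedKummerType n K)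
    (h1 : ∀ x : complexBetti K 1, x = 0) {α : complexBetti A.X 2} {Λ_A : Module.End ℂ (totalCohomology ℂ (Motives.ComplexPoints A.X))}
    (hΛA : IsDualLefschetz 2 α Λ_A) {Λ₀ : Module.End ℂ (totalCohomology ℂ (Motives.ComplexPoints K))}
    (hΛ₀ : IsDualLefschetz (2 * n) (complexBetti.map j 2 (𝔊.divisorClass (n + 1) α)) Λ₀) (ℓ : complexBetti K 2)
    (Λ : Module.End ℂ (totalCohomology ℂ (Motives.ComplexPoints K))) (hΛ : IsDualLefschetz (2 * n) ℓ Λ) : LefschetzGenerationKumAt K Λ :=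
  lefschetzGenerationKumAt_of_one hF (by omega) hKs hKt hΛ₀
    (lefschetzGenerationKumAt_of_hilbW hV0 hB hL hA hn hS H 𝔊 h𝔊 hCg hC hh 𝒜 x₀ j hsq hKs h1 α Λ_A hΛA Λ₀ hΛ₀) ℓ Λ hΛ

end Summit.Ventures.HodgeKum4

end
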